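import Summits.Parity.GeneralizedHardyLittlewood.Theorems.GreenTaoLevelTwoMNTwoVerticalDecomposition
import Summits.Parity.GeneralizedHardyLittlewood.Theorems.GreenTaoLevelTwoMNTwoSectionEightComplex

/-!
# Route `GreenTaoLevelTwo`, crux `MNTwo` (stmt-Parity-21276), line `birth`, stub `stub_mnVertical`:
# `stub_mnVertical` FROM PROPOSITION 19 of GT 2008b (blocks V3 + V7 + V8 assembled)

Block V8 of the `stub_mnVertical` census (B. Green, T. Tao, *Quadratic uniformity of the Möbius
function*, Ann. Inst. Fourier 58 (2008) = arXiv:math/0606087, §2: "Proof of the Main Theorem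
assuming Theorem 4 and Proposition 5").  The registered stub `stub_mnVertical` (Möbius is
orthogonal to the VERTICAL-CHARACTER nilsequences on every `X^m × ℝ/ℤ`, `X ∈ 𝒞₂(H_d)`, with a
constant `C M^B`, here `B = 1`) follows from PROPOSITION 19 of the source in printed form for every
torus dimension `k` (hypothesis `hP`, verbatim the hypothesis of
`…MNTwoSectionEightComplex.sum_moebius_localQuadratic_complex_le` = Theorem 4 ⟸ Prop. 19, block
V3) via the exact vertical-character form of Proposition 5
(`…MNTwoVerticalDecomposition.vertical_decomposition_verticalClass`, block V7): decompose
`F(gⁿx) = 2∑_p F_p(ξ + nα)e(−φ_p(n))`, reindex the torus `ℝ^I` by `Fin (card I)`, apply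
Theorem 4 to each of the `card P` pieces (Lipschitz constant `(2K+1)M`) and add up.  What remains
for the stub is exactly `hP` (blocks V4–V6 = §§9–12 of the source).  Def-free:

* `stub_mnVertical_of_prop19` — `(∀ k, Prop19 k) → stub_mnVertical` (signature verbatim).

References: [GreenTao2008QuadraticMobius] arXiv:math/0606087, §2, Thm. 4, Prop. 5, Prop. 19.
-/

noncomputable section

open Finset Real ArithmeticFunction
open scoped FourierTransform ArithmeticFunction.Moebius
open Literature.NumberTheory.Sieve
open Literature.NumberTheory.Sieve.GreenTaoLevelTwo (HX IsCompatMetric IsBoxComparable heisenbergWith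
  InHeisClass)

namespace Summit.Parity.GeneralizedHardyLittlewood.GreenTaoLevelTwoMNTwoVerticalOfPropNineteen

open Summit.Parity.GeneralizedHardyLittlewood.GreenTaoLevelTwoMNTwoVerticalDecomposition
  (vertical_decomposition_verticalClass)
open Summit.Parity.GeneralizedHardyLittlewood.GreenTaoLevelTwoMNTwoSectionEightComplex
  (sum_moebius_localQuadratic_complex_le)

/-- Restriction along an equivalence of index types is `1`-Lipschitz for the sup-distances.
[folklore] -/
theorem dist_comp_equiv_le {I : Type} [Fintype I] {k : ℕ} (e : I ≃ Fin k) (y y' : Fin k → ℝ) :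
    dist (fun i => y (e i)) (fun i => y' (e i)) ≤ dist y y' :=
  (dist_pi_le_iff dist_nonneg).mpr fun i => dist_le_pi_dist y y' (e i)

/-- **`stub_mnVertical` from Proposition 19 (all torus dimensions).**  The hypothesis `hP k` is,
verbatim, the hypothesis of `…MNTwoSectionEightComplex.sum_moebius_localQuadratic_complex_le`; the
conclusion is, verbatim, the registered signature of `stub_mnVertical` (with `B = 1`).
[cite: GreenTao2008QuadraticMobius, §2 (proof of the Main Theorem from Thm. 4 and Prop. 5)] -/
theorem stub_mnVertical_of_prop19
    (hP : ∀ k : ℕ, ∀ A : ℝ, 0 < A → ∃ C : ℝ, ∀ N : ℕ, 2 ≤ N → ∀ (α : Fin k → ℝ) (n₀ : ℤ) (ρ : ℝ),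
      0 < ρ → 100000 * ρ < 1 →
      (∀ n : ℤ, ((∀ i, ‖((((n - n₀ : ℤ) : ℝ) * α i : ℝ) : AddCircle (1 : ℝ))‖ +
          |((n - n₀ : ℤ) : ℝ)| / N < 100 * ρ) ∧ |((n - n₀ : ℤ) : ℝ)| / N < 100 * ρ) →
        (N : ℤ) < n ∧ n ≤ 2 * N) →
      ∀ φ : ℤ → ℝ,
        (∀ n h₁ h₂ h₃ : ℤ,
          (∀ e₁ e₂ e₃ : ℕ, e₁ ≤ 1 → e₂ ≤ 1 → e₃ ≤ 1 →
            (∀ i, ‖((((n + e₁ * h₁ + e₂ * h₂ + e₃ * h₃ - n₀ : ℤ) : ℝ) * α i : ℝ) :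
                AddCircle (1 : ℝ))‖ +
              |((n + e₁ * h₁ + e₂ * h₂ + e₃ * h₃ - n₀ : ℤ) : ℝ)| / N < 100 * ρ) ∧
            |((n + e₁ * h₁ + e₂ * h₂ + e₃ * h₃ - n₀ : ℤ) : ℝ)| / N < 100 * ρ) →
          ∃ z : ℤ, φ (n + h₁ + h₂ + h₃) - φ (n + h₁ + h₂) - φ (n + h₁ + h₃) - φ (n + h₂ + h₃)
            + φ (n + h₁) + φ (n + h₂) + φ (n + h₃) - φ n = z) →
        ∀ ψ : ℤ → ℝ, (∀ n, 0 ≤ ψ n) →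
          (∀ n, ψ n ≠ 0 →
            (∀ i, ‖((((n - n₀ : ℤ) : ℝ) * α i : ℝ) : AddCircle (1 : ℝ))‖ +
                |((n - n₀ : ℤ) : ℝ)| / N < ρ) ∧ |((n - n₀ : ℤ) : ℝ)| / N < ρ) →
          (∀ (n n' : ℤ) (t : ℝ), 0 ≤ t →
            (∀ i, ‖((((n - n' : ℤ) : ℝ) * α i : ℝ) : AddCircle (1 : ℝ))‖ ≤ t) →
              |ψ n - ψ n'| ≤ t + |((n - n' : ℤ) : ℝ)| / N) →
          ‖∑ n ∈ Ioc N (2 * N), ((μ n : ℝ) : ℂ) * ((ψ n : ℝ) : ℂ) * (𝐞 (-(φ n)) : ℂ)‖ ≤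
            C * N / Real.log N ^ A) :
    (∀ (d : HX → HX → ℝ) (h : IsCompatMetric d), IsBoxComparable d →
      ∀ X : Nilmanifold 2, InHeisClass (heisenbergWith d h) X → ∀ m : ℕ,
        ∀ A : ℝ, 0 < A → ∃ C B : ℝ, ∀ M : ℝ, 1 ≤ M → ∀ N : ℕ, 2 ≤ N →
          ∀ (g : ((X.pow m).prod (Nilmanifold.circle.ofLE one_le_two)).G) (x : ((X.pow m).prod (Nilmanifold.circle.ofLE one_le_two)).G ⧸ ((X.pow m).prod (Nilmanifold.circle.ofLE one_le_two)).Γ) (F₁ F₂ : ((X.pow m).prod (Nilmanifold.circle.ofLE one_le_two)).G ⧸ ((X.pow m).prod (Nilmanifold.circle.ofLE one_le_two)).Γ → ℝ),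
            ((X.pow m).prod (Nilmanifold.circle.ofLE one_le_two)).IsBoundedLipschitz M F₁ → ((X.pow m).prod (Nilmanifold.circle.ofLE one_le_two)).IsBoundedLipschitz M F₂ →
            (∃ θ : ((X.pow m).prod (Nilmanifold.circle.ofLE one_le_two)).G → ℝ, ∀ z : ((X.pow m).prod (Nilmanifold.circle.ofLE one_le_two)).G, z ∈ Subgroup.center ((X.pow m).prod (Nilmanifold.circle.ofLE one_le_two)).G →
              ∀ x : ((X.pow m).prod (Nilmanifold.circle.ofLE one_le_two)).G ⧸ ((X.pow m).prod (Nilmanifold.circle.ofLE one_le_two)).Γ,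
                ((F₁ (z • x) : ℂ) + (F₂ (z • x) : ℂ) * Complex.I) =
                  Complex.exp (2 * Real.pi * Complex.I * θ z) * ((F₁ x : ℂ) + (F₂ x : ℂ) * Complex.I)) →
              ‖∑ n ∈ Finset.Icc 1 N, ((ArithmeticFunction.moebius n : ℝ) : ℂ) *
                  ((F₁ (g ^ n • x) : ℂ) + (F₂ (g ^ n • x) : ℂ) * Complex.I)‖ ≤
                C * M ^ B * N / Real.log N ^ A) := by
  classical
  intro d h hd X hX m A hA
  obtain ⟨I, iI, P, iP, K, hK, hdec⟩ := vertical_decomposition_verticalClass d h hd X hX m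
  obtain ⟨C, hC⟩ := sum_moebius_localQuadratic_complex_le (Fintype.card I) (hP (Fintype.card I)) hA
  set e : I ≃ Fin (Fintype.card I) := Fintype.equivFin I with he
  refine ⟨2 * (Fintype.card P) * (C * (2 * K + 1)), 1, ?_⟩
  intro M hM N hN g x F₁ F₂ hF₁ hF₂ hvert
  have hM0 : 0 ≤ M := by linarith
  obtain ⟨α, xv, Fp, φ, hper, hbd, hlip, hquad, hident⟩ :=
    hdec M hM0 F₁ F₂ hF₁ hF₂ hvert g x
  -- the Lipschitz constant fed to Theorem 4
  have hM' : 1 ≤ (2 * K + 1) * M := by nlinarith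
  -- each piece, reindexed by `Fin (card I)`, satisfies the bound of Theorem 4
  have hpiece : ∀ p : P,
      ‖∑ n ∈ Icc 1 N, ((μ n : ℝ) : ℂ) * Fp p (xv + (n : ℝ) • α) * (𝐞 (-(φ p n)) : ℂ)‖ ≤
        C * ((2 * K + 1) * M) * N / Real.log N ^ A := by
    intro p
    -- the reindexed data
    have hre : ∀ t : ℝ, (fun i => ((fun j => xv (e.symm j)) + t • (fun j => α (e.symm j))) (e i)) =
        xv + t • α := by
      intro t; funext i; simp
    have key := hC ((2 * K + 1) * M) hM' (fun y => Fp p (fun i => y (e i)))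
      (fun y j => ?_) (fun y => hbd p _) (fun y y' => ?_) N hN (fun j => α (e.symm j))
      (fun j => xv (e.symm j)) (φ p) (fun n h₁ h₂ h₃ hcube => ?_)
    · -- conclusion, after undoing the reindexing
      simp only [hre] at key
      exact key
    · -- periodicity under `Pi.single j 1`
      have hv : (fun i => (y + Pi.single j (1 : ℝ) : Fin (Fintype.card I) → ℝ) (e i)) =
          (fun i => y (e i)) + fun i => (((if e i = j then (1 : ℤ) else 0 : ℤ)) : ℝ) := by
        funext i
        simp only [Pi.add_apply, Pi.single_apply]
        split_ifs <;> simp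
      rw [hv, hper]
    · -- Lipschitz bound
      refine (hlip p _ _).trans ?_
      have hd := dist_comp_equiv_le e y y'
      have h0 : 0 ≤ dist (fun i => y (e i)) (fun i => y' (e i)) := dist_nonneg
      have h1 : K * (M + 1) ≤ (2 * K + 1) * M := by nlinarith
      calc K * (M + 1) * dist (fun i => y (e i)) (fun i => y' (e i))
          ≤ (2 * K + 1) * M * dist (fun i => y (e i)) (fun i => y' (e i)) :=
            mul_le_mul_of_nonneg_right h1 h0
        _ ≤ (2 * K + 1) * M * dist y y' := by
            exact mul_le_mul_of_nonneg_left hd (by positivity)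
    · -- local quadraticity on the support inside `[1, N]`
      refine hquad p n h₁ h₂ h₃ fun e₁ e₂ e₃ he₁ he₂ he₃ => ?_
      obtain ⟨-, -, h3⟩ := hcube e₁ e₂ e₃ he₁ he₂ he₃
      rwa [hre] at h3
  -- add up the pieces
  have hsum : ∑ n ∈ Icc 1 N, ((μ n : ℝ) : ℂ) * ((F₁ (g ^ n • x) : ℂ) + (F₂ (g ^ n • x) : ℂ) * Complex.I) =
      2 * ∑ p, ∑ n ∈ Icc 1 N, ((μ n : ℝ) : ℂ) * Fp p (xv + (n : ℝ) • α) * (𝐞 (-(φ p n)) : ℂ) := by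
    calc ∑ n ∈ Icc 1 N, ((μ n : ℝ) : ℂ) * ((F₁ (g ^ n • x) : ℂ) + (F₂ (g ^ n • x) : ℂ) * Complex.I)
        = ∑ n ∈ Icc 1 N, ∑ p, 2 * (((μ n : ℝ) : ℂ) * Fp p (xv + (n : ℝ) • α) * (𝐞 (-(φ p n)) : ℂ)) :=
          Finset.sum_congr rfl fun n _ => by
            rw [hident n, Finset.mul_sum, Finset.mul_sum]
            exact Finset.sum_congr rfl fun p _ => by ring
      _ = ∑ p, ∑ n ∈ Icc 1 N, 2 * (((μ n : ℝ) : ℂ) * Fp p (xv + (n : ℝ) • α) * (𝐞 (-(φ p n)) : ℂ)) :=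
          Finset.sum_comm
      _ = 2 * ∑ p, ∑ n ∈ Icc 1 N, ((μ n : ℝ) : ℂ) * Fp p (xv + (n : ℝ) • α) * (𝐞 (-(φ p n)) : ℂ) := by
          rw [Finset.mul_sum]
          exact Finset.sum_congr rfl fun p _ => by rw [Finset.mul_sum]
  rw [hsum, norm_mul, Complex.norm_two, Real.rpow_one]
  have hle := Finset.sum_le_sum fun p (_ : p ∈ (Finset.univ : Finset P)) => hpiece p
  rw [Finset.sum_const, Finset.card_univ, nsmul_eq_mul] at hle
  calc 2 * ‖∑ p, ∑ n ∈ Icc 1 N, ((μ n : ℝ) : ℂ) * Fp p (xv + (n : ℝ) • α) * (𝐞 (-(φ p n)) : ℂ)‖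
      ≤ 2 * ((Fintype.card P : ℝ) * (C * ((2 * K + 1) * M) * N / Real.log N ^ A)) := by
        gcongr
        exact (norm_sum_le _ _).trans hle
    _ = 2 * (Fintype.card P) * (C * (2 * K + 1)) * M * N / Real.log N ^ A := by ring

end Summit.Parity.GeneralizedHardyLittlewood.GreenTaoLevelTwoMNTwoVerticalOfPropNineteen
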